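import Mathlib
import Summits.AtomisticToContinuum.HydrodynamicLimit.Theorems.ImplosionDichotomyDenseExcursionCavityCentreRSystem
import Summits.AtomisticToContinuum.HydrodynamicLimit.Theorems.ImplosionDichotomyDenseExcursionCavityResFuchsUniform

/-!
# The regular branch at the centre in the signed radius with a UNIFORM weighted bound (theorem T7(i), brick (α))
# (crux `DenseExcursion`, line `sonic-cavity-renewal`, brick for stub `stub_cavityResolventCk`)

Helper file (`--supports stmt-AtomisticToContinuum-12586`, line lead a2, stub-worker E2 for `stub_cavityResolventCk`).
Quantitative form of `centre_R_branch` (`…CavityCentreRSystem`; registered helper `centre_R_branch_uniform`): for a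
monatomic profile and a bound `R₀` there are `δ > 0` and `K ≥ 0` such that FOR EVERY `Λ` WITH `‖Λ‖ ≤ R₀`, every
regular source `(f, g)` and every `c₀ : ℂ`, the system for `u(R) = ŵ(log|R|)`, `c(R) = |R|·ŝ(log|R|)` has a solution of
class `C^∞` on `(−δ, δ)`, even there, with `c(0) = c₀`, solving the resolvent equation `Λŵ − linW = f`,
`Λŝ − linS = g` for `eˣ < δ` (verbatim `centre_R_branch`), AND with the weighted bound

  `‖u(eʸ)‖ + ‖c(eʸ)‖ ≤ K (‖c₀‖ + N)`   for `eʸ ≤ R₁`,   whenever   `‖f(y)‖ + eʸ‖g(y)‖ ≤ N` for `eʸ ≤ R₁`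

(`0 < R₁ < δ`): the weighted sup `‖ŵ‖ + eˣ‖ŝ‖` of the branch on `x ≤ log R₁` is controlled by `‖c₀‖` and the weighted
sup of the source on the SAME half-line (causality), uniformly in `‖Λ‖ ≤ R₀`. Mechanism: the coefficients of the
`R`-system are affine in `Λ` with smooth `Λ`-independent parts, so their bounds (and that of `a₁₁′`) on `[−1, 1]` are
uniform on `‖Λ‖ ≤ R₀`; the sources are bounded by the radial data `|f(log|R|)| + |R|·|g(log|R|)|`; the uniform smooth
branch `fuchs_branch_uniform` (exponent `−3`) supplies radius, solution, evenness and the a priori bound.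
Sources: folklore (Coddington–Levinson 1955 Ch. 4 §2).
-/

noncomputable section

open Set Filter
open scoped Topology ContDiff

namespace Summit.AtomisticToContinuum.HydrodynamicLimit.Theorems.SonicCavityRenewal

open Summit.AtomisticToContinuum.HydrodynamicLimit.Theorems.R2OneModeTwoConditions

/-- UNIFORM BOUND OF AN AFFINE FAMILY: for continuous `F, G : ℝ → ℂ` there is `C ≥ 0` with
`‖F s + Λ G s‖ ≤ C (1 + ‖Λ‖)` on `[−1, 1]` for every `Λ`. [folklore] -/
theorem exists_bound_affine {F G : ℝ → ℂ} (hF : Continuous F) (hG : Continuous G) :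
    ∃ C : ℝ, 0 ≤ C ∧ ∀ (Λ : ℂ), ∀ s ∈ Icc (-1 : ℝ) 1, ‖F s + Λ * G s‖ ≤ C * (1 + ‖Λ‖) := by
  have hK : IsCompact (Icc (-1 : ℝ) 1) := isCompact_Icc
  obtain ⟨CF, hCF⟩ := hK.exists_bound_of_continuousOn hF.continuousOn
  obtain ⟨CG, hCG⟩ := hK.exists_bound_of_continuousOn hG.continuousOn
  have hCF0 : 0 ≤ CF := (norm_nonneg _).trans (hCF 0 (by norm_num))
  have hCG0 : 0 ≤ CG := (norm_nonneg _).trans (hCG 0 (by norm_num))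
  refine ⟨CF + CG, by positivity, fun Λ s hs => ?_⟩
  calc ‖F s + Λ * G s‖ ≤ ‖F s‖ + ‖Λ‖ * ‖G s‖ := (norm_add_le _ _).trans (by rw [norm_mul])
    _ ≤ CF + ‖Λ‖ * CG := add_le_add (hCF s hs) (mul_le_mul_of_nonneg_left (hCG s hs) (norm_nonneg _))
    _ ≤ (CF + CG) * (1 + ‖Λ‖) := by nlinarith [norm_nonneg Λ]

/-- RADIAL SOURCE BOUND: if `‖f y‖ + eʸ‖g y‖ ≤ N` for `eʸ ≤ R₁` (`R₁ > 0`) and `𝒻, 𝓰` are continuous with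
`𝒻 R = f(log|R|)`, `𝓰 R = |R|·g(log|R|)` for `R ≠ 0`, then `‖𝒻 s‖ + ‖𝓰 s‖ ≤ N` on `[−R₁, R₁]` (at `s = 0` by continuity).
[folklore] -/
theorem radial_source_bound {f g 𝒻 𝓰 : ℝ → ℂ} {R₁ N : ℝ} (hR₁ : 0 < R₁) (h𝒻 : Continuous 𝒻) (h𝓰 : Continuous 𝓰)
    (hval : ∀ R, R ≠ 0 → 𝒻 R = f (Real.log |R|) ∧ 𝓰 R = |R| * g (Real.log |R|))
    (hN : ∀ y : ℝ, Real.exp y ≤ R₁ → ‖f y‖ + Real.exp y * ‖g y‖ ≤ N) :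
    ∀ s ∈ Icc (-R₁) R₁, ‖𝒻 s‖ + ‖𝓰 s‖ ≤ N := by
  have hne : ∀ s, s ≠ 0 → |s| ≤ R₁ → ‖𝒻 s‖ + ‖𝓰 s‖ ≤ N := by
    intro s hs0 hs
    obtain ⟨h1, h2⟩ := hval s hs0
    have hpos : 0 < |s| := abs_pos.2 hs0
    have := hN (Real.log |s|) (by rw [Real.exp_log hpos]; exact hs)
    rw [Real.exp_log hpos] at this
    rw [h1, h2, norm_mul, Complex.norm_real, Real.norm_eq_abs, abs_abs]
    exact this
  intro s hs
  rcases eq_or_ne s 0 with rfl | hs0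
  · have hc : Tendsto (fun s => ‖𝒻 s‖ + ‖𝓰 s‖) (𝓝[>] (0 : ℝ)) (𝓝 (‖𝒻 0‖ + ‖𝓰 0‖)) :=
      ((h𝒻.norm.add h𝓰.norm).tendsto 0).mono_left nhdsWithin_le_nhds
    refine le_of_tendsto hc ?_
    filter_upwards [Ioc_mem_nhdsGT hR₁] with t ht
    exact hne t ht.1.ne' (by rw [abs_of_pos ht.1]; exact ht.2)
  · exact hne s hs0 (abs_le.2 ⟨hs.1, hs.2⟩)

/-- **Registered helper `centre_R_branch_uniform`: THE REGULAR BRANCH IN THE SIGNED RADIUS WITH A UNIFORM WEIGHTED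
BOUND.** See the module docstring. [folklore] -/
theorem centre_R_branch_uniform : ∀ (r : ℝ) (W S : ℝ → ℝ), IsMonatomicProfile r W S → ∀ R₀ : ℝ, ∃ δ : ℝ, 0 < δ ∧ ∃ K : ℝ, 0 ≤ K ∧ ∀ Λ : ℂ, ‖Λ‖ ≤ R₀ → ∀ (f g : ℝ → ℂ), IsRegularPair f g → ∀ c₀ : ℂ, ∃ u c : ℝ → ℂ, ContDiffOn ℝ ∞ u (Set.Ioo (-δ) δ) ∧ ContDiffOn ℝ ∞ c (Set.Ioo (-δ) δ) ∧ (∀ R ∈ Set.Ioo (-δ) δ, u (-R) = u R ∧ c (-R) = c R) ∧ c 0 = c₀ ∧ (∀ x : ℝ, Real.exp x < δ → Λ * u (Real.exp x) - linW r W S (fun y => u (Real.exp y)) (fun y => (Real.exp (-y) : ℂ) * c (Real.exp y)) x = f x ∧ Λ * ((Real.exp (-x) : ℂ) * c (Real.exp x)) - linS r W S (fun y => u (Real.exp y)) (fun y => (Real.exp (-y) : ℂ) * c (Real.exp y)) x = g x) ∧ ∀ (R₁ N : ℝ), 0 < R₁ → R₁ < δ → (∀ y : ℝ, Real.exp y ≤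 R₁ → ‖f y‖ + Real.exp y * ‖g y‖ ≤ N) → ∀ y : ℝ, Real.exp y ≤ R₁ → ‖u (Real.exp y)‖ + ‖c (Real.exp y)‖ ≤ K * (‖c₀‖ + N) := by
  intro r W S hP R₀
  obtain ⟨𝓌, σ, h𝓌, hσ, heven, hval, hσpos⟩ := profile_radial_data r W S hP
  have h𝓌' : ContDiff ℝ ∞ (deriv 𝓌) := (contDiff_infty_iff_deriv.1 h𝓌).2
  have hσ' : ContDiff ℝ ∞ (deriv σ) := (contDiff_infty_iff_deriv.1 hσ).2
  have h𝓌e : ∀ R, 𝓌 (-R) = 𝓌 R := fun R => (heven R).1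
  have hσe : ∀ R, σ (-R) = σ R := fun R => (heven R).2
  have h𝓌'o : ∀ R, deriv 𝓌 (-R) = -deriv 𝓌 R := deriv_neg_of_even h𝓌e
  have hσ'o : ∀ R, deriv σ (-R) = -deriv σ R := deriv_neg_of_even hσe
  -- the determinant and its globalisation
  set D : ℝ → ℝ := fun R => (𝓌 R - 1) ^ 2 * R ^ 2 - σ R ^ 2 with hD
  have hDs : ContDiff ℝ ∞ D := by rw [hD]; fun_prop
  have hDe : ∀ R, D (-R) = D R := fun R => by simp only [hD, h𝓌e, hσe]; ring
  have hD0 : D 0 < 0 := by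
    simp only [hD]
    have := hσpos 0
    nlinarith
  obtain ⟨Dt, hDts, hDte, hDt0, ρ, hρ, hDtD⟩ := exists_even_nonvanishing_eq_near_zero hDs hDe hD0
  -- the `Λ`-independent smooth pieces
  set p : ℝ → ℂ := fun R => ((R * deriv 𝓌 R + 2 * 𝓌 R - r : ℝ) : ℂ) with hpdef
  set q : ℝ → ℂ := fun R => ((1 + 𝓌 R + R * deriv 𝓌 R / 3 - r : ℝ) : ℂ) with hqdef
  have cR : ContDiff ℝ ∞ fun R : ℝ => (R : ℂ) := Complex.ofRealCLM.contDiff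
  have rP : ContDiff ℝ ∞ fun R : ℝ => R * deriv 𝓌 R + 2 * 𝓌 R - r := by fun_prop
  have rQ : ContDiff ℝ ∞ fun R : ℝ => 1 + 𝓌 R + R * deriv 𝓌 R / 3 - r := by fun_prop
  have r1 : ContDiff ℝ ∞ fun R : ℝ => (𝓌 R - 1) * R := by fun_prop
  have r2 : ContDiff ℝ ∞ fun R : ℝ => 3 * σ R := by fun_prop
  have r3 : ContDiff ℝ ∞ fun R : ℝ => R * deriv σ R + σ R := by fun_prop
  have r4 : ContDiff ℝ ∞ fun R : ℝ => 3 * deriv σ R := by fun_prop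
  have r5 : ContDiff ℝ ∞ fun R : ℝ => σ R / 3 := by fun_prop
  have hps : ContDiff ℝ ∞ p := by rw [hpdef]; exact Complex.ofRealCLM.contDiff.comp rP
  have hqs : ContDiff ℝ ∞ q := by rw [hqdef]; exact Complex.ofRealCLM.contDiff.comp rQ
  have hDti : ContDiff ℝ ∞ fun R => ((Dt R : ℝ) : ℂ)⁻¹ :=
    (Complex.ofRealCLM.contDiff.comp hDts).inv fun R => Complex.ofReal_ne_zero.2 (hDt0 R)
  have c1 : ContDiff ℝ ∞ fun R => (((𝓌 R - 1) * R : ℝ) : ℂ) := Complex.ofRealCLM.contDiff.comp r1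
  have c2 : ContDiff ℝ ∞ fun R => ((3 * σ R : ℝ) : ℂ) := Complex.ofRealCLM.contDiff.comp r2
  have c3 : ContDiff ℝ ∞ fun R => ((R * deriv σ R + σ R : ℝ) : ℂ) := Complex.ofRealCLM.contDiff.comp r3
  have c4 : ContDiff ℝ ∞ fun R => ((3 * deriv σ R : ℝ) : ℂ) := Complex.ofRealCLM.contDiff.comp r4
  have c5 : ContDiff ℝ ∞ fun R => ((σ R / 3 : ℝ) : ℂ) := Complex.ofRealCLM.contDiff.comp r5
  -- the affine decomposition of the coefficients: `aᵢⱼ = Fᵢⱼ + Λ Gᵢⱼ`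
  set F₁₁ : ℝ → ℂ := fun R => (((3 * σ R : ℝ) : ℂ) * ((R * deriv σ R + σ R : ℝ) : ℂ) -
    (((𝓌 R - 1) * R : ℝ) : ℂ) * ((R : ℂ) * p R)) * ((Dt R : ℝ) : ℂ)⁻¹ with hF₁₁
  set G₁₁ : ℝ → ℂ := fun R => (((𝓌 R - 1) * R : ℝ) : ℂ) * (R : ℂ) * ((Dt R : ℝ) : ℂ)⁻¹ with hG₁₁
  set F₁₂ : ℝ → ℂ := fun R => (-(((𝓌 R - 1) * R : ℝ) : ℂ) * ((3 * deriv σ R : ℝ) : ℂ) +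
    ((3 * σ R : ℝ) : ℂ) * q R) * ((Dt R : ℝ) : ℂ)⁻¹ with hF₁₂
  set G₁₂ : ℝ → ℂ := fun R => -((3 * σ R : ℝ) : ℂ) * ((Dt R : ℝ) : ℂ)⁻¹ with hG₁₂
  set F₂₁ : ℝ → ℂ := fun R => (((σ R / 3 : ℝ) : ℂ) * ((R : ℂ) * p R) -
    (((𝓌 R - 1) * R : ℝ) : ℂ) * ((R * deriv σ R + σ R : ℝ) : ℂ)) * ((Dt R : ℝ) : ℂ)⁻¹ with hF₂₁
  set G₂₁ : ℝ → ℂ := fun R => -((σ R / 3 : ℝ) : ℂ) * (R : ℂ) * ((Dt R : ℝ) : ℂ)⁻¹ with hG₂₁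
  set F₂₂ : ℝ → ℂ := fun R => (((σ R / 3 : ℝ) : ℂ) * ((3 * deriv σ R : ℝ) : ℂ) -
    (((𝓌 R - 1) * R : ℝ) : ℂ) * q R) * ((Dt R : ℝ) : ℂ)⁻¹ with hF₂₂
  set G₂₂ : ℝ → ℂ := fun R => (((𝓌 R - 1) * R : ℝ) : ℂ) * ((Dt R : ℝ) : ℂ)⁻¹ with hG₂₂
  have sF₁₁ : ContDiff ℝ ∞ F₁₁ := by rw [hF₁₁]; exact ((c2.mul c3).sub (c1.mul (cR.mul hps))).mul hDti
  have sG₁₁ : ContDiff ℝ ∞ G₁₁ := by rw [hG₁₁]; exact (c1.mul cR).mul hDti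
  have sF₁₂ : ContDiff ℝ ∞ F₁₂ := by rw [hF₁₂]; exact ((c1.neg.mul c4).add (c2.mul hqs)).mul hDti
  have sG₁₂ : ContDiff ℝ ∞ G₁₂ := by rw [hG₁₂]; exact c2.neg.mul hDti
  have sF₂₁ : ContDiff ℝ ∞ F₂₁ := by rw [hF₂₁]; exact ((c5.mul (cR.mul hps)).sub (c1.mul c3)).mul hDti
  have sG₂₁ : ContDiff ℝ ∞ G₂₁ := by rw [hG₂₁]; exact (c5.neg.mul cR).mul hDti
  have sF₂₂ : ContDiff ℝ ∞ F₂₂ := by rw [hF₂₂]; exact ((c5.mul c4).sub (c1.mul hqs)).mul hDti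
  have sG₂₂ : ContDiff ℝ ∞ G₂₂ := by rw [hG₂₂]; exact c1.mul hDti
  have sF₁₁' : ContDiff ℝ ∞ (deriv F₁₁) := (contDiff_infty_iff_deriv.1 sF₁₁).2
  have sG₁₁' : ContDiff ℝ ∞ (deriv G₁₁) := (contDiff_infty_iff_deriv.1 sG₁₁).2
  -- uniform bounds on `‖Λ‖ ≤ R₀`
  obtain ⟨C₁, hC₁0, hC₁⟩ := exists_bound_affine sF₁₁'.continuous sG₁₁'.continuous
  obtain ⟨C₂, hC₂0, hC₂⟩ := exists_bound_affine sF₁₂.continuous sG₁₂.continuous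
  obtain ⟨C₃, hC₃0, hC₃⟩ := exists_bound_affine sF₂₁.continuous sG₂₁.continuous
  obtain ⟨C₄, hC₄0, hC₄⟩ := exists_bound_affine sF₂₂.continuous sG₂₂.continuous
  set M : ℝ := 1 + max R₀ 0 with hM
  have hM0 : 0 ≤ M := by positivity
  obtain ⟨δ₀, hδ₀, hδ₀1, K, hK, hfuchs⟩ := fuchs_branch_uniform (C₁ * M) (C₂ * M) (C₃ * M) (C₄ * M) (by positivity)
    (by positivity) (by positivity) (by positivity)
  -- the source coefficient bound
  have sS : Continuous fun R : ℝ => ‖(((𝓌 R - 1) * R : ℝ) : ℂ) * (R : ℂ) * ((Dt R : ℝ) : ℂ)⁻¹‖ +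
      ‖((3 * σ R : ℝ) : ℂ) * ((Dt R : ℝ) : ℂ)⁻¹‖ + ‖((σ R / 3 : ℝ) : ℂ) * (R : ℂ) * ((Dt R : ℝ) : ℂ)⁻¹‖ +
      ‖(((𝓌 R - 1) * R : ℝ) : ℂ) * ((Dt R : ℝ) : ℂ)⁻¹‖ :=
    ((((c1.mul cR).mul hDti).continuous.norm.add (c2.mul hDti).continuous.norm).add
      ((c5.mul cR).mul hDti).continuous.norm).add (c1.mul hDti).continuous.norm
  obtain ⟨Cb, hCb⟩ := (isCompact_Icc (a := (-1 : ℝ)) (b := 1)).exists_bound_of_continuousOn sS.continuousOn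
  have hCb0 : 0 ≤ Cb := (norm_nonneg _).trans (hCb 0 (by norm_num))
  -- the radius and the constant
  set δ : ℝ := min δ₀ ρ with hδ
  have hδpos : 0 < δ := lt_min hδ₀ hρ
  refine ⟨δ, hδpos, 2 * K * (1 + Cb), by positivity, fun Λ hΛ f g hfg c₀ => ?_⟩
  have hΛM : 1 + ‖Λ‖ ≤ M := by rw [hM]; linarith [le_max_left R₀ 0]
  -- the coefficients for this `Λ`
  set P : ℝ → ℂ := fun R => Λ - p R with hPdef
  set Q : ℝ → ℂ := fun R => Λ - q R with hQdef
  set a₁₁ : ℝ → ℂ := fun R => F₁₁ R + Λ * G₁₁ R with ha₁₁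
  set a₁₂ : ℝ → ℂ := fun R => F₁₂ R + Λ * G₁₂ R with ha₁₂
  set a₂₁ : ℝ → ℂ := fun R => F₂₁ R + Λ * G₂₁ R with ha₂₁
  set a₂₂ : ℝ → ℂ := fun R => F₂₂ R + Λ * G₂₂ R with ha₂₂
  have ha₁₁s : ContDiff ℝ ∞ a₁₁ := sF₁₁.add (contDiff_const.mul sG₁₁)
  have ha₁₂s : ContDiff ℝ ∞ a₁₂ := sF₁₂.add (contDiff_const.mul sG₁₂)
  have ha₂₁s : ContDiff ℝ ∞ a₂₁ := sF₂₁.add (contDiff_const.mul sG₂₁)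
  have ha₂₂s : ContDiff ℝ ∞ a₂₂ := sF₂₂.add (contDiff_const.mul sG₂₂)
  have hda₁₁ : ∀ s, deriv a₁₁ s = deriv F₁₁ s + Λ * deriv G₁₁ s := fun s => by
    have h1 : HasDerivAt F₁₁ (deriv F₁₁ s) s := (sF₁₁.differentiable (by simp) s).hasDerivAt
    have h2 : HasDerivAt G₁₁ (deriv G₁₁ s) s := (sG₁₁.differentiable (by simp) s).hasDerivAt
    exact (h1.add (h2.const_mul Λ)).deriv
  have hbd : ∀ s ∈ Icc (-1 : ℝ) 1, ‖deriv a₁₁ s‖ ≤ C₁ * M ∧ ‖a₁₂ s‖ ≤ C₂ * M ∧ ‖a₂₁ s‖ ≤ C₃ * M ∧ ‖a₂₂ s‖ ≤ C₄ * M := by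
    intro s hs
    refine ⟨?_, ?_, ?_, ?_⟩
    · rw [hda₁₁]; exact (hC₁ Λ s hs).trans (mul_le_mul_of_nonneg_left hΛM hC₁0)
    · exact (hC₂ Λ s hs).trans (mul_le_mul_of_nonneg_left hΛM hC₂0)
    · exact (hC₃ Λ s hs).trans (mul_le_mul_of_nonneg_left hΛM hC₃0)
    · exact (hC₄ Λ s hs).trans (mul_le_mul_of_nonneg_left hΛM hC₄0)
  -- the residue
  have ha₁₁0 : a₁₁ 0 = -(3 : ℂ) := by
    have hDt00 : Dt 0 = -σ 0 ^ 2 := by rw [hDtD 0 (by simpa using hρ)]; simp [hD]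
    have hσ0 : (σ 0 : ℂ) ≠ 0 := Complex.ofReal_ne_zero.2 (hσpos 0).ne'
    simp only [ha₁₁, hF₁₁, hG₁₁, hDt00]
    push_cast
    field_simp
    ring
  -- parities
  have hpe : ∀ R, p (-R) = p R := fun R => by simp only [hpdef, h𝓌e, h𝓌'o]; push_cast; ring
  have hqe : ∀ R, q (-R) = q R := fun R => by simp only [hqdef, h𝓌e, h𝓌'o]; push_cast; ring
  have ha₁₁e : ∀ R, a₁₁ (-R) = a₁₁ R := fun R => by
    simp only [ha₁₁, hF₁₁, hG₁₁, hpe, h𝓌e, hσe, hσ'o, hDte]; push_cast; ring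
  have ha₁₂e : ∀ R, a₁₂ (-R) = a₁₂ R := fun R => by
    simp only [ha₁₂, hF₁₂, hG₁₂, hqe, h𝓌e, hσe, hσ'o, hDte]; push_cast; ring
  have ha₂₁o : ∀ R, a₂₁ (-R) = -a₂₁ R := fun R => by
    simp only [ha₂₁, hF₂₁, hG₂₁, hpe, h𝓌e, hσe, hσ'o, hDte]; push_cast; ring
  have ha₂₂o : ∀ R, a₂₂ (-R) = -a₂₂ R := fun R => by
    simp only [ha₂₂, hF₂₂, hG₂₂, hqe, h𝓌e, hσe, hσ'o, hDte]; push_cast; ring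
  have hmain := hfuchs (-3) a₁₁ a₁₂ a₂₁ a₂₂ (by norm_num) ha₁₁s ha₁₂s ha₂₁s ha₂₂s ha₁₁0 hbd
  -- the sources
  obtain ⟨𝒻, 𝓰, h𝒻, h𝓰, hseven, hsval⟩ := source_radial_data hfg
  have h𝒻e : ∀ R, 𝒻 (-R) = 𝒻 R := fun R => (hseven R).1
  have h𝓰e : ∀ R, 𝓰 (-R) = 𝓰 R := fun R => (hseven R).2
  set b₁ : ℝ → ℂ := fun R => ((((𝓌 R - 1) * R : ℝ) : ℂ) * (-((R : ℂ) * 𝒻 R)) + ((3 * σ R : ℝ) : ℂ) * 𝓰 R) *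
    ((Dt R : ℝ) : ℂ)⁻¹ with hb₁
  set b₂ : ℝ → ℂ := fun R => (((σ R / 3 : ℝ) : ℂ) * ((R : ℂ) * 𝒻 R) - (((𝓌 R - 1) * R : ℝ) : ℂ) * 𝓰 R) *
    ((Dt R : ℝ) : ℂ)⁻¹ with hb₂
  have hb₁s : ContDiff ℝ ∞ b₁ := by rw [hb₁]; exact ((c1.mul (cR.mul h𝒻).neg).add (c2.mul h𝓰)).mul hDti
  have hb₂s : ContDiff ℝ ∞ b₂ := by rw [hb₂]; exact ((c5.mul (cR.mul h𝒻)).sub (c1.mul h𝓰)).mul hDti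
  have hb₁e : ∀ R, b₁ (-R) = b₁ R := fun R => by
    simp only [hb₁, h𝓌e, hσe, h𝒻e, h𝓰e, hDte]; push_cast; ring
  have hb₂o : ∀ R, b₂ (-R) = -b₂ R := fun R => by
    simp only [hb₂, h𝓌e, hσe, h𝒻e, h𝓰e, hDte]; push_cast; ring
  have hbsrc : ∀ s ∈ Icc (-1 : ℝ) 1, ‖b₁ s‖ ≤ Cb * (‖𝒻 s‖ + ‖𝓰 s‖) ∧ ‖b₂ s‖ ≤ Cb * (‖𝒻 s‖ + ‖𝓰 s‖) := by
    intro s hs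
    set k₁ := ‖(((𝓌 s - 1) * s : ℝ) : ℂ) * (s : ℂ) * ((Dt s : ℝ) : ℂ)⁻¹‖ with hk₁d
    set k₂ := ‖((3 * σ s : ℝ) : ℂ) * ((Dt s : ℝ) : ℂ)⁻¹‖ with hk₂d
    set k₃ := ‖((σ s / 3 : ℝ) : ℂ) * (s : ℂ) * ((Dt s : ℝ) : ℂ)⁻¹‖ with hk₃d
    set k₄ := ‖(((𝓌 s - 1) * s : ℝ) : ℂ) * ((Dt s : ℝ) : ℂ)⁻¹‖ with hk₄d
    have hk₁ : 0 ≤ k₁ := norm_nonneg _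
    have hk₂ : 0 ≤ k₂ := norm_nonneg _
    have hk₃ : 0 ≤ k₃ := norm_nonneg _
    have hk₄ : 0 ≤ k₄ := norm_nonneg _
    have hk : k₁ + k₂ + k₃ + k₄ ≤ Cb := by
      have := hCb s hs
      rwa [Real.norm_of_nonneg (by positivity)] at this
    have e1 : b₁ s = -((((𝓌 s - 1) * s : ℝ) : ℂ) * (s : ℂ) * ((Dt s : ℝ) : ℂ)⁻¹) * 𝒻 s +
        (((3 * σ s : ℝ) : ℂ) * ((Dt s : ℝ) : ℂ)⁻¹) * 𝓰 s := by simp only [hb₁]; ring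
    have e2 : b₂ s = (((σ s / 3 : ℝ) : ℂ) * (s : ℂ) * ((Dt s : ℝ) : ℂ)⁻¹) * 𝒻 s -
        ((((𝓌 s - 1) * s : ℝ) : ℂ) * ((Dt s : ℝ) : ℂ)⁻¹) * 𝓰 s := by simp only [hb₂]; ring
    have n1 : ‖-((((𝓌 s - 1) * s : ℝ) : ℂ) * (s : ℂ) * ((Dt s : ℝ) : ℂ)⁻¹) * 𝒻 s‖ = k₁ * ‖𝒻 s‖ := by
      rw [norm_mul, norm_neg]
    have n2 : ‖(((3 * σ s : ℝ) : ℂ) * ((Dt s : ℝ) : ℂ)⁻¹) * 𝓰 s‖ = k₂ * ‖𝓰 s‖ := by rw [norm_mul]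
    have n3 : ‖(((σ s / 3 : ℝ) : ℂ) * (s : ℂ) * ((Dt s : ℝ) : ℂ)⁻¹) * 𝒻 s‖ = k₃ * ‖𝒻 s‖ := by rw [norm_mul]
    have n4 : ‖((((𝓌 s - 1) * s : ℝ) : ℂ) * ((Dt s : ℝ) : ℂ)⁻¹) * 𝓰 s‖ = k₄ * ‖𝓰 s‖ := by rw [norm_mul]
    have hf0 : 0 ≤ ‖𝒻 s‖ := norm_nonneg _
    have hg0 : 0 ≤ ‖𝓰 s‖ := norm_nonneg _
    constructor
    · rw [e1]
      refine (norm_add_le _ _).trans ?_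
      rw [n1, n2]
      nlinarith [mul_le_mul_of_nonneg_right (show k₁ ≤ Cb by linarith) hf0,
        mul_le_mul_of_nonneg_right (show k₂ ≤ Cb by linarith) hg0]
    · rw [e2]
      refine (norm_sub_le _ _).trans ?_
      rw [n3, n4]
      nlinarith [mul_le_mul_of_nonneg_right (show k₃ ≤ Cb by linarith) hf0,
        mul_le_mul_of_nonneg_right (show k₄ ≤ Cb by linarith) hg0]
  obtain ⟨hex, hap, hevn⟩ := hmain b₁ b₂ hb₁s hb₂s
  obtain ⟨u, c, hus, hcs, hc0, hode⟩ := hex c₀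
  have hsubδ : Ioo (-δ) δ ⊆ Ioo (-δ₀) δ₀ := Ioo_subset_Ioo (by rw [hδ]; linarith [min_le_left δ₀ ρ]) (min_le_left _ _)
  have hevenuc : ∀ R ∈ Ioo (-δ) δ, u (-R) = u R ∧ c (-R) = c R := fun R hR =>
    hevn ha₁₁e ha₁₂e hb₁e ha₂₁o ha₂₂o hb₂o u c δ₀ hδ₀ le_rfl (hus.of_le (by exact_mod_cast le_top))
      (hcs.of_le (by exact_mod_cast le_top)) hode R (hsubδ hR)
  refine ⟨u, c, hus.mono hsubδ, hcs.mono hsubδ, hevenuc, hc0, fun x hx => ?_, fun R₁ N hR₁ hR₁δ hN y hy => ?_⟩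
  · -- THE EQUATIONS at `R = eˣ ∈ (0, δ)` (verbatim `centre_R_branch`)
    set R : ℝ := Real.exp x with hRdef
    have hRpos : 0 < R := Real.exp_pos x
    have hR0 : R ≠ 0 := hRpos.ne'
    have hRabs : |R| = R := abs_of_pos hRpos
    have hlog : Real.log |R| = x := by rw [hRabs, hRdef, Real.log_exp]
    have hRI : R ∈ Ioo (-δ₀) δ₀ := ⟨by linarith [min_le_left δ₀ ρ], lt_of_lt_of_le hx (min_le_left _ _)⟩
    have hRρ : |R| < ρ := by rw [hRabs]; exact lt_of_lt_of_le hx (min_le_right _ _)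
    have hDtR : Dt R = (𝓌 R - 1) ^ 2 * R ^ 2 - σ R ^ 2 := hDtD R hRρ
    have hDR0 : (((𝓌 R - 1) ^ 2 * R ^ 2 - σ R ^ 2 : ℝ) : ℂ) ≠ 0 := by
      rw [← hDtR]; exact Complex.ofReal_ne_zero.2 (hDt0 R)
    have hDR0' : ((𝓌 R : ℂ) - 1) ^ 2 * (R : ℂ) ^ 2 - (σ R : ℂ) ^ 2 ≠ 0 := by exact_mod_cast hDR0
    obtain ⟨h1, h2⟩ := hode R hRI
    have hWfun : ∀ y, W y = 𝓌 (Real.exp y) := fun y => by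
      have := (hval (Real.exp y) (Real.exp_pos y).ne').1
      rw [abs_of_pos (Real.exp_pos y), Real.log_exp] at this
      exact this.symm
    have hSfun : ∀ y, S y = σ (Real.exp y) * (Real.exp y)⁻¹ := fun y => by
      have := (hval (Real.exp y) (Real.exp_pos y).ne').2
      rw [abs_of_pos (Real.exp_pos y), Real.log_exp] at this
      rw [this]; field_simp
    have hW : W x = 𝓌 R := hWfun x
    have hW' : deriv W x = R * deriv 𝓌 R := by
      have h : HasDerivAt (fun y => 𝓌 (Real.exp y)) (Real.exp x • deriv 𝓌 (Real.exp x)) x :=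
        ((h𝓌.differentiable (by simp)) _).hasDerivAt.scomp x (Real.hasDerivAt_exp x)
      rw [show W = fun y => 𝓌 (Real.exp y) from funext hWfun, h.deriv, smul_eq_mul]
    have hS : S x = σ R / R := by rw [hSfun x, div_eq_mul_inv]
    have hS' : deriv S x = deriv σ R - σ R / R := by
      have h1' : HasDerivAt (fun y => σ (Real.exp y)) (Real.exp x • deriv σ (Real.exp x)) x :=
        ((hσ.differentiable (by simp)) _).hasDerivAt.scomp x (Real.hasDerivAt_exp x)
      have h2' := (Real.hasDerivAt_exp x).inv (Real.exp_pos x).ne'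
      have h3' : HasDerivAt (fun y => σ (Real.exp y) * (Real.exp y)⁻¹) _ x := h1'.mul h2'
      rw [show S = fun y => σ (Real.exp y) * (Real.exp y)⁻¹ from funext hSfun, h3'.deriv, smul_eq_mul]
      field_simp
      ring
    have hŵ' : deriv (fun y => u (Real.exp y)) x = (R : ℂ) * deriv u R :=
      deriv_comp_exp (((hus.differentiableOn (by simp)) R hRI).differentiableAt (isOpen_Ioo.mem_nhds hRI))
    have hŝ : (Real.exp (-x) : ℂ) * c (Real.exp x) = c R / (R : ℂ) := by
      rw [Real.exp_neg, Complex.ofReal_inv, div_eq_inv_mul]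
    have hŝ' : deriv (fun y => (Real.exp (-y) : ℂ) * c (Real.exp y)) x = deriv c R - c R / (R : ℂ) :=
      deriv_exp_neg_mul_comp_exp (((hcs.differentiableOn (by simp)) R hRI).differentiableAt (isOpen_Ioo.mem_nhds hRI))
    obtain ⟨hfR, hgR⟩ := hsval R hR0
    rw [hlog] at hfR hgR
    -- the determinant identity `Dt⁻¹ · ((𝓌 − 1)²R² − σ²) = 1` on `|R| < ρ`
    have hDtinv : (((Dt R : ℝ) : ℂ))⁻¹ * (((𝓌 R : ℝ) : ℂ) - 1) ^ 2 * ((R : ℝ) : ℂ) ^ 2 -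
        (((Dt R : ℝ) : ℂ))⁻¹ * ((σ R : ℝ) : ℂ) ^ 2 = 1 := by
      have h : (((Dt R : ℝ) : ℂ))⁻¹ * ((Dt R : ℝ) : ℂ) = 1 := inv_mul_cancel₀ (Complex.ofReal_ne_zero.2 (hDt0 R))
      nth_rw 2 [hDtR] at h
      push_cast at h
      linear_combination h
    have hE1 : (((𝓌 R - 1) * R : ℝ) : ℂ) * ((R : ℂ) * deriv u R) + ((3 * σ R : ℝ) : ℂ) * deriv c R =
        (R : ℂ) * (Λ - ((R * deriv 𝓌 R + 2 * 𝓌 R - r : ℝ) : ℂ)) * u R - ((3 * deriv σ R : ℝ) : ℂ) * c R - (R : ℂ) * 𝒻 R := by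
      rw [h1, h2]
      simp only [ha₁₁, ha₁₂, hb₁, ha₂₁, ha₂₂, hb₂, hF₁₁, hG₁₁, hF₁₂, hG₁₂, hF₂₁, hG₂₁, hF₂₂, hG₂₂, hpdef, hqdef]
      push_cast
      linear_combination ((R : ℂ) * (Λ - ((R : ℂ) * ((deriv 𝓌 R : ℝ) : ℂ) + 2 * ((𝓌 R : ℝ) : ℂ) - ((r : ℝ) : ℂ))) * u R -
        3 * ((deriv σ R : ℝ) : ℂ) * c R - (R : ℂ) * 𝒻 R) * hDtinv
    have hE2 : ((σ R / 3 : ℝ) : ℂ) * ((R : ℂ) * deriv u R) + (((𝓌 R - 1) * R : ℝ) : ℂ) * deriv c R =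
        (Λ - ((1 + 𝓌 R + R * deriv 𝓌 R / 3 - r : ℝ) : ℂ)) * c R - ((R * deriv σ R + σ R : ℝ) : ℂ) * u R - 𝓰 R := by
      rw [h1, h2]
      simp only [ha₁₁, ha₁₂, hb₁, ha₂₁, ha₂₂, hb₂, hF₁₁, hG₁₁, hF₁₂, hG₁₂, hF₂₁, hG₂₁, hF₂₂, hG₂₂, hpdef, hqdef]
      push_cast
      linear_combination ((Λ - (1 + ((𝓌 R : ℝ) : ℂ) + (R : ℂ) * ((deriv 𝓌 R : ℝ) : ℂ) / 3 - ((r : ℝ) : ℂ))) * c R -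
        ((R : ℂ) * ((deriv σ R : ℝ) : ℂ) + ((σ R : ℝ) : ℂ)) * u R - 𝓰 R) * hDtinv
    obtain ⟨hw, hs⟩ := lin_of_R_system (Λ := Λ) (ŵ := fun y => u (Real.exp y))
      (ŝ := fun y => (Real.exp (-y) : ℂ) * c (Real.exp y)) hR0 hW hW' hS hS' rfl hŵ' hŝ hŝ' hE1 hE2
    refine ⟨by rw [hw, hfR], ?_⟩
    have hRc : (R : ℂ) ≠ 0 := Complex.ofReal_ne_zero.2 hR0
    rw [hs, hgR, hRabs]
    field_simp
  · -- THE WEIGHTED BOUND on `eʸ ≤ R₁ < δ`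
    have hR₁δ₀ : R₁ < δ₀ := lt_of_lt_of_le hR₁δ (min_le_left _ _)
    have hN0 : 0 ≤ N :=
      (by positivity : (0 : ℝ) ≤ ‖f (Real.log R₁)‖ + Real.exp (Real.log R₁) * ‖g (Real.log R₁)‖).trans
        (hN (Real.log R₁) (by rw [Real.exp_log hR₁]))
    have hsrc : ∀ s ∈ Icc (-R₁) R₁, ‖b₁ s‖ ≤ Cb * N ∧ ‖b₂ s‖ ≤ Cb * N := by
      intro s hs
      have hs1 : s ∈ Icc (-1 : ℝ) 1 := ⟨by linarith [hs.1], by linarith [hs.2]⟩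
      have hfg' := radial_source_bound hR₁ h𝒻.continuous h𝓰.continuous hsval hN s hs
      obtain ⟨e1, e2⟩ := hbsrc s hs1
      exact ⟨e1.trans (mul_le_mul_of_nonneg_left hfg' hCb0), e2.trans (mul_le_mul_of_nonneg_left hfg' hCb0)⟩
    have hRy : Real.exp y ∈ Icc (-R₁) R₁ := ⟨by linarith [Real.exp_pos y], hy⟩
    obtain ⟨k1, k2⟩ := hap u c δ₀ hδ₀ le_rfl (hus.of_le (by exact_mod_cast le_top)) (hcs.of_le (by exact_mod_cast le_top))
      hode R₁ (Cb * N) hR₁.le hR₁δ₀ hsrc (Real.exp y) hRy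
    rw [hc0] at k1 k2
    have hc₀ : 0 ≤ ‖c₀‖ := norm_nonneg _
    have h1 : ‖c₀‖ + Cb * N ≤ (1 + Cb) * (‖c₀‖ + N) := by
      have e : (1 + Cb) * (‖c₀‖ + N) = ‖c₀‖ + Cb * N + (N + Cb * ‖c₀‖) := by ring
      rw [e]
      have : 0 ≤ N + Cb * ‖c₀‖ := add_nonneg hN0 (mul_nonneg hCb0 hc₀)
      linarith
    have hK' : K * (‖c₀‖ + Cb * N) ≤ K * (1 + Cb) * (‖c₀‖ + N) := by
      calc K * (‖c₀‖ + Cb * N) ≤ K * ((1 + Cb) * (‖c₀‖ + N)) := mul_le_mul_of_nonneg_left h1 hK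
        _ = K * (1 + Cb) * (‖c₀‖ + N) := by ring
    have e2 : 2 * K * (1 + Cb) * (‖c₀‖ + N) = K * (1 + Cb) * (‖c₀‖ + N) + K * (1 + Cb) * (‖c₀‖ + N) := by ring
    rw [e2]
    exact add_le_add (k1.trans hK') (k2.trans hK')

end Summit.AtomisticToContinuum.HydrodynamicLimit.Theorems.SonicCavityRenewal

end
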